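import Summits.QuantumAdvantage.QuantumAdvantage.Theorems.SymplecticPurityDlogGraphFlatHolder

/-!
# Crux `DlogGraphFlat` (stmt-QuantumAdvantage-10732), line `Sketch` — sector B: the fourth moment as a
# sum of 4-fold dilation correlations; paired tuples; the sign-free residual (`stub_dlogFDMweakOfDCB`)

For a digit mask `D`, block patterns `PJ = {u ≼ D}`, multipliers `c_u = g^{ofBits u}`, the digital
function `F_β(y) = (−1)^{β·bits y}` on `𝔽_p` and ANY signs `ε_u = ±1`,

  `Σ_λ (Σ_{u ∈ PJ} ε_u F_β(λ c_u))⁴ = Σ_{q ∈ PJ⁴} (Π ε) · K(q)`,  `K(q) = Σ_λ Π_{k=1}^4 F_β(λ c_{q_k})`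

(`sum_pow_four_expand`). On the PAIRED tuples (`q₁ = q₂ ∧ q₃ = q₄`, or `q₁ = q₃ ∧ q₂ = q₄`, or
`q₁ = q₄ ∧ q₂ = q₃`) the summand is exactly `p` (`paired_prod_eq_one`), and there are at most `3|PJ|²` of
them (`card_paired_le`). Hence the weak fourth-moment hypothesis FDMweak of
`stub_dlogWalshHolderWeak` (file `…HolderWeak`) follows from the SIGN-FREE, `α`-FREE bound

  DCB:  `Σ_{q ∈ PJ⁴ non-paired} |K(q)| ≤ C · 2^{(3−κ)|D|} · p`   for some mask `D` with `|D| ≥ μ n`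

(`stub_dlogFDMweakOfDCB`, constants `κ' = min κ 1`, `C' = C + 3`). DCB is the honest open core of
sector B in its final form: a power saving, on average over the non-paired 4-tuples of a sparse
geometric cube `{g^{ofBits u} : u ≼ D}`, in the 4-fold dilation correlations of ONE digital function.
No new definitions.
-/

set_option linter.dupNamespace false -- D-0017: single-problem summit ⇒ `QuantumAdvantage.QuantumAdvantage` by design

namespace Summit.QuantumAdvantage.QuantumAdvantage.Theorems.SymplecticPurity

open Finset Literature.Computability.QuantumComplexity Literature.Computability.Cryptography

section FDMReduce

variable {n : ℕ}

/-- Expansion of a fourth power of a finite sum as a sum over 4-tuples `((a,b),(c,d))`. -/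
theorem sum_pow_four_expand {ι : Type*} (s : Finset ι) (f : ι → ℝ) :
    (∑ u ∈ s, f u) ^ 4 = ∑ q ∈ (s ×ˢ s) ×ˢ (s ×ˢ s), f q.1.1 * f q.1.2 * (f q.2.1 * f q.2.2) := by
  have h2 : (∑ u ∈ s, f u) ^ 2 = ∑ ab ∈ s ×ˢ s, f ab.1 * f ab.2 := by
    rw [sq, Finset.sum_mul_sum, ← Finset.sum_product']
  rw [show (4 : ℕ) = 2 + 2 from rfl, pow_add, h2, Finset.sum_mul_sum, ← Finset.sum_product']

/-- The paired 4-tuples of a finite set number at most `3|s|²`. -/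
theorem card_paired_le {ι : Type*} [DecidableEq ι] (s : Finset ι) :
    (((s ×ˢ s) ×ˢ (s ×ˢ s)).filter fun q : (ι × ι) × (ι × ι) =>
        (q.1.1 = q.1.2 ∧ q.2.1 = q.2.2) ∨ (q.1.1 = q.2.1 ∧ q.1.2 = q.2.2) ∨
          (q.1.1 = q.2.2 ∧ q.1.2 = q.2.1)).card ≤ 3 * (s.card * s.card) := by
  classical
  set P1 := ((s ×ˢ s) ×ˢ (s ×ˢ s)).filter fun q : (ι × ι) × (ι × ι) =>
    q.1.1 = q.1.2 ∧ q.2.1 = q.2.2 with hP1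
  set P2 := ((s ×ˢ s) ×ˢ (s ×ˢ s)).filter fun q : (ι × ι) × (ι × ι) =>
    q.1.1 = q.2.1 ∧ q.1.2 = q.2.2 with hP2
  set P3 := ((s ×ˢ s) ×ˢ (s ×ˢ s)).filter fun q : (ι × ι) × (ι × ι) =>
    q.1.1 = q.2.2 ∧ q.1.2 = q.2.1 with hP3
  have hsub : (((s ×ˢ s) ×ˢ (s ×ˢ s)).filter fun q : (ι × ι) × (ι × ι) =>
        (q.1.1 = q.1.2 ∧ q.2.1 = q.2.2) ∨ (q.1.1 = q.2.1 ∧ q.1.2 = q.2.2) ∨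
          (q.1.1 = q.2.2 ∧ q.1.2 = q.2.1)) ⊆ P1 ∪ P2 ∪ P3 := by
    intro q hq
    rw [Finset.mem_filter] at hq
    rw [Finset.mem_union, Finset.mem_union, hP1, hP2, hP3, Finset.mem_filter, Finset.mem_filter,
      Finset.mem_filter]
    tauto
  -- each Pi injects into s × s
  have hc1 : P1.card ≤ s.card * s.card := by
    rw [← Finset.card_product]
    refine Finset.card_le_card_of_injOn (fun q => (q.1.1, q.2.1)) ?_ ?_
    · intro q hq
      rw [hP1, Finset.mem_coe, Finset.mem_filter, Finset.mem_product, Finset.mem_product,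
        Finset.mem_product] at hq
      rw [Finset.mem_coe, Finset.mem_product]
      exact ⟨hq.1.1.1, hq.1.2.1⟩
    · intro q hq q' hq' h
      rw [hP1, Finset.mem_coe, Finset.mem_filter] at hq hq'
      simp only [Prod.mk.injEq] at h
      obtain ⟨⟨a, b⟩, ⟨c, d⟩⟩ := q
      obtain ⟨⟨a', b'⟩, ⟨c', d'⟩⟩ := q'
      simp only [Prod.mk.injEq] at h hq hq' ⊢
      obtain ⟨h1, h2⟩ := h
      obtain ⟨e1, e2⟩ := hq.2
      obtain ⟨e1', e2'⟩ := hq'.2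
      subst_vars
      exact ⟨⟨rfl, rfl⟩, rfl, rfl⟩
  have hc2 : P2.card ≤ s.card * s.card := by
    rw [← Finset.card_product]
    refine Finset.card_le_card_of_injOn (fun q => (q.1.1, q.1.2)) ?_ ?_
    · intro q hq
      rw [hP2, Finset.mem_coe, Finset.mem_filter, Finset.mem_product, Finset.mem_product,
        Finset.mem_product] at hq
      rw [Finset.mem_coe, Finset.mem_product]
      exact ⟨hq.1.1.1, hq.1.1.2⟩
    · intro q hq q' hq' h
      rw [hP2, Finset.mem_coe, Finset.mem_filter] at hq hq'
      simp only [Prod.mk.injEq] at h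
      obtain ⟨⟨a, b⟩, ⟨c, d⟩⟩ := q
      obtain ⟨⟨a', b'⟩, ⟨c', d'⟩⟩ := q'
      simp only [Prod.mk.injEq] at h hq hq' ⊢
      obtain ⟨h1, h2⟩ := h
      obtain ⟨e1, e2⟩ := hq.2
      obtain ⟨e1', e2'⟩ := hq'.2
      subst_vars
      exact ⟨⟨rfl, rfl⟩, rfl, rfl⟩
  have hc3 : P3.card ≤ s.card * s.card := by
    rw [← Finset.card_product]
    refine Finset.card_le_card_of_injOn (fun q => (q.1.1, q.1.2)) ?_ ?_
    · intro q hq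
      rw [hP3, Finset.mem_coe, Finset.mem_filter, Finset.mem_product, Finset.mem_product,
        Finset.mem_product] at hq
      rw [Finset.mem_coe, Finset.mem_product]
      exact ⟨hq.1.1.1, hq.1.1.2⟩
    · intro q hq q' hq' h
      rw [hP3, Finset.mem_coe, Finset.mem_filter] at hq hq'
      simp only [Prod.mk.injEq] at h
      obtain ⟨⟨a, b⟩, ⟨c, d⟩⟩ := q
      obtain ⟨⟨a', b'⟩, ⟨c', d'⟩⟩ := q'
      simp only [Prod.mk.injEq] at h hq hq' ⊢
      obtain ⟨h1, h2⟩ := h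
      obtain ⟨e1, e2⟩ := hq.2
      obtain ⟨e1', e2'⟩ := hq'.2
      subst_vars
      exact ⟨⟨rfl, rfl⟩, rfl, rfl⟩
  calc _ ≤ (P1 ∪ P2 ∪ P3).card := Finset.card_le_card hsub
    _ ≤ (P1 ∪ P2).card + P3.card := Finset.card_union_le _ _
    _ ≤ (P1.card + P2.card) + P3.card := Nat.add_le_add_right (Finset.card_union_le _ _) _
    _ ≤ 3 * (s.card * s.card) := by omega

/-- On a paired tuple the product of four `±1`-valued factors is `1`. -/
theorem paired_prod_eq_one {ι : Type*} (f : ι → ℝ) (hf : ∀ u, f u = 1 ∨ f u = -1)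
    (q : (ι × ι) × (ι × ι))
    (hq : (q.1.1 = q.1.2 ∧ q.2.1 = q.2.2) ∨ (q.1.1 = q.2.1 ∧ q.1.2 = q.2.2) ∨
      (q.1.1 = q.2.2 ∧ q.1.2 = q.2.1)) :
    f q.1.1 * f q.1.2 * (f q.2.1 * f q.2.2) = 1 := by
  have hsq : ∀ u, f u * f u = 1 := by
    intro u; rcases hf u with h | h <;> rw [h] <;> norm_num
  rcases hq with ⟨h1, h2⟩ | ⟨h1, h2⟩ | ⟨h1, h2⟩
  · rw [h1, h2, hsq, hsq, one_mul]
  · rw [h1, h2]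
    calc f q.2.1 * f q.2.2 * (f q.2.1 * f q.2.2)
        = (f q.2.1 * f q.2.1) * (f q.2.2 * f q.2.2) := by ring
      _ = 1 := by rw [hsq, hsq, one_mul]
  · rw [h1, h2]
    calc f q.2.2 * f q.2.1 * (f q.2.1 * f q.2.2)
        = (f q.2.1 * f q.2.1) * (f q.2.2 * f q.2.2) := by ring
      _ = 1 := by rw [hsq, hsq, one_mul]

/-- **`stub_dlogFDMweakOfDCB`**: the sign-free dilation-correlation bound DCB implies the weak
fourth-moment hypothesis FDMweak of `stub_dlogWalshHolderWeak`. DCB: for `κ, μ, C > 0`, all large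
`n`, every admissible `(p, g)` and every `β ≠ 0`, SOME digit mask `D` with `|D| ≥ μ n` has
`Σ_{q ∈ PJ⁴, q not paired} |Σ_λ Π_{k} F_β(λ g^{ofBits q_k})| ≤ C · 2^{(3−κ)|D|} · p`.
Proof: expand the fourth power, swap sums, paired tuples contribute exactly `p` each and number
`≤ 3·4^{|D|}`, the rest is bounded by DCB through the triangle inequality; `κ' = min κ 1`,
`C' = C + 3`. -/
theorem stub_dlogFDMweakOfDCB :
    (∃ κ : ℝ, 0 < κ ∧ ∃ μ : ℝ, 0 < μ ∧ ∃ C : ℝ, 0 < C ∧ ∃ n₀ : ℕ, ∀ n ≥ n₀,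
      ∀ (p : ℕ) [Fact (Nat.Prime p)] (g : ℕ), p < 2 ^ n → 2 ^ n ≤ p + 2 ^ (53 * n / 100) →
      orderOf (g : ZMod p) = p - 1 →
      (∀ c : Fin (n + 1) → ℤ, (∀ i, c i = 0 ∨ c i = 1 ∨ c i = -1) →
        ∑ i, c i * 2 ^ (i : ℕ) = (p : ℤ) - 1 → n ≤ 8 * (Finset.univ.filter fun i => c i ≠ 0).card) →
      ∀ β : QReg n, β ≠ (fun _ => false) →
      ∃ D : QReg n, μ * (n : ℝ) ≤ ((Finset.univ.filter fun j => D j = true).card : ℝ) ∧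
      ∑ q ∈ (((Finset.univ.filter fun u : QReg n => ∀ j : Fin n, D j = false → u j = false) ×ˢ
              (Finset.univ.filter fun u : QReg n => ∀ j : Fin n, D j = false → u j = false)) ×ˢ
            ((Finset.univ.filter fun u : QReg n => ∀ j : Fin n, D j = false → u j = false) ×ˢ
              (Finset.univ.filter fun u : QReg n => ∀ j : Fin n, D j = false → u j = false))).filter
          fun q => ¬ ((q.1.1 = q.1.2 ∧ q.2.1 = q.2.2) ∨ (q.1.1 = q.2.1 ∧ q.1.2 = q.2.2) ∨
            (q.1.1 = q.2.2 ∧ q.1.2 = q.2.1)),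
        |∑ lam : ZMod p,
          (∏ i : Fin n, (if β i && (lam * (g : ZMod p) ^ Nat.ofBits q.1.1).val.testBit (i : ℕ)
            then (-1 : ℝ) else 1)) *
          (∏ i : Fin n, (if β i && (lam * (g : ZMod p) ^ Nat.ofBits q.1.2).val.testBit (i : ℕ)
            then (-1 : ℝ) else 1)) *
          ((∏ i : Fin n, (if β i && (lam * (g : ZMod p) ^ Nat.ofBits q.2.1).val.testBit (i : ℕ)
            then (-1 : ℝ) else 1)) *
          (∏ i : Fin n, (if β i && (lam * (g : ZMod p) ^ Nat.ofBits q.2.2).val.testBit (i : ℕ)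
            then (-1 : ℝ) else 1)))| ≤
        C * (2 : ℝ) ^ ((3 - κ) * ((Finset.univ.filter fun j => D j = true).card : ℝ)) * p) →
    (∃ κ : ℝ, 0 < κ ∧ ∃ μ : ℝ, 0 < μ ∧ ∃ C : ℝ, 0 < C ∧ ∃ n₀ : ℕ, ∀ n ≥ n₀,
      ∀ (p : ℕ) [Fact (Nat.Prime p)] (g : ℕ), p < 2 ^ n → 2 ^ n ≤ p + 2 ^ (53 * n / 100) →
      orderOf (g : ZMod p) = p - 1 →
      (∀ c : Fin (n + 1) → ℤ, (∀ i, c i = 0 ∨ c i = 1 ∨ c i = -1) →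
        ∑ i, c i * 2 ^ (i : ℕ) = (p : ℤ) - 1 → n ≤ 8 * (Finset.univ.filter fun i => c i ≠ 0).card) →
      ∀ β : QReg n, β ≠ (fun _ => false) → ∀ α : QReg n,
      ∃ D : QReg n, μ * (n : ℝ) ≤ ((Finset.univ.filter fun j => D j = true).card : ℝ) ∧
      ∑ lam : ZMod p,
        (∑ u ∈ (Finset.univ.filter fun u : QReg n => ∀ j : Fin n, D j = false → u j = false),
          (∏ i : Fin n, (if α i && u i then (-1 : ℝ) else 1)) *
            ∏ i : Fin n, (if β i && (lam * (g : ZMod p) ^ Nat.ofBits u).val.testBit (i : ℕ)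
              then (-1 : ℝ) else 1)) ^ 4 ≤
        C * (2 : ℝ) ^ ((3 - κ) * ((Finset.univ.filter fun j => D j = true).card : ℝ)) * p) := by
  rintro ⟨κ, hκ, μ, hμ, C, hC, n₀, hF⟩
  refine ⟨min κ 1, lt_min hκ one_pos, μ, hμ, C + 3, by linarith, n₀, ?_⟩
  intro n hn p _ g hpn hwin hg hguard β hβ α
  classical
  obtain ⟨D, hDμ, hDCB⟩ := hF n hn p g hpn hwin hg hguard β hβ
  refine ⟨D, hDμ, ?_⟩
  set G : ZMod p := (g : ZMod p) with hG
  set F : ZMod p → ℝ := fun y => ∏ i : Fin n, (if β i && y.val.testBit (i : ℕ) then (-1 : ℝ) else 1)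
    with hFdef
  set A : QReg n → ℝ := fun z => ∏ i : Fin n, (if α i && z i then (-1 : ℝ) else 1) with hA
  set PJ := Finset.univ.filter fun u : QReg n => ∀ j : Fin n, D j = false → u j = false with hPJ
  set m : ℕ := (Finset.univ.filter fun j => D j = true).card with hm
  set Q := (PJ ×ˢ PJ) ×ˢ (PJ ×ˢ PJ) with hQ
  set pr : ((QReg n × QReg n) × (QReg n × QReg n)) → Prop := fun q =>
    (q.1.1 = q.1.2 ∧ q.2.1 = q.2.2) ∨ (q.1.1 = q.2.1 ∧ q.1.2 = q.2.2) ∨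
      (q.1.1 = q.2.2 ∧ q.1.2 = q.2.1) with hpr
  set K : ((QReg n × QReg n) × (QReg n × QReg n)) → ℝ := fun q => ∑ lam : ZMod p,
    F (lam * G ^ Nat.ofBits q.1.1) * F (lam * G ^ Nat.ofBits q.1.2) *
      (F (lam * G ^ Nat.ofBits q.2.1) * F (lam * G ^ Nat.ofBits q.2.2)) with hK
  -- the goal, restated through the abbreviations
  change ∑ lam : ZMod p, (∑ u ∈ PJ, A u * F (lam * G ^ Nat.ofBits u)) ^ 4 ≤
    (C + 3) * (2 : ℝ) ^ ((3 - min κ 1) * (m : ℝ)) * p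
  change ∑ q ∈ Q.filter (fun q => ¬ pr q), |K q| ≤ C * (2 : ℝ) ^ ((3 - κ) * (m : ℝ)) * p at hDCB
  -- Step 1: expand and swap
  have hexp : ∑ lam : ZMod p, (∑ u ∈ PJ, A u * F (lam * G ^ Nat.ofBits u)) ^ 4 =
      ∑ q ∈ Q, A q.1.1 * A q.1.2 * (A q.2.1 * A q.2.2) * K q := by
    rw [Finset.sum_congr rfl (fun lam _ => sum_pow_four_expand PJ (fun u => A u * F (lam * G ^ Nat.ofBits u))),
      Finset.sum_comm]
    refine Finset.sum_congr rfl fun q _ => ?_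
    rw [hK]; simp only
    rw [Finset.mul_sum]
    refine Finset.sum_congr rfl fun lam _ => ?_
    ring
  rw [hexp, ← Finset.sum_filter_add_sum_filter_not Q pr]
  -- Step 2: paired tuples
  have hF1 : ∀ y, F y = 1 ∨ F y = -1 := fun y => sign_prod_cases β (fun i : Fin n => y.val.testBit (i : ℕ))
  have hA1 : ∀ z, A z = 1 ∨ A z = -1 := fun z => sign_prod_cases α z
  have hpaired : ∀ q ∈ Q.filter pr, A q.1.1 * A q.1.2 * (A q.2.1 * A q.2.2) * K q = p := by
    intro q hq
    rw [Finset.mem_filter] at hq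
    rw [paired_prod_eq_one A hA1 q hq.2, one_mul, hK]
    simp only
    have hterm : ∀ lam : ZMod p, F (lam * G ^ Nat.ofBits q.1.1) * F (lam * G ^ Nat.ofBits q.1.2) *
        (F (lam * G ^ Nat.ofBits q.2.1) * F (lam * G ^ Nat.ofBits q.2.2)) = 1 := by
      intro lam
      exact paired_prod_eq_one (fun u => F (lam * G ^ Nat.ofBits u)) (fun u => hF1 _) q hq.2
    rw [Finset.sum_congr rfl (fun lam _ => hterm lam), Finset.sum_const, Finset.card_univ,
      ZMod.card, nsmul_eq_mul, mul_one]
  have hP : ∑ q ∈ Q.filter pr, A q.1.1 * A q.1.2 * (A q.2.1 * A q.2.2) * K q ≤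
      3 * ((2 : ℝ) ^ m * (2 : ℝ) ^ m) * p := by
    rw [Finset.sum_congr rfl hpaired, Finset.sum_const, nsmul_eq_mul]
    refine mul_le_mul_of_nonneg_right ?_ (Nat.cast_nonneg _)
    have hc := card_paired_le PJ
    rw [← hQ] at hc
    have hPJ2 : PJ.card ≤ 2 ^ m := by
      have h1 : PJ ⊆ Finset.univ.image fun x : QReg n => fun j => x j && D j := by
        intro u hu
        rw [hPJ, Finset.mem_filter] at hu
        rw [Finset.mem_image]
        refine ⟨u, Finset.mem_univ _, ?_⟩
        funext j
        have := hu.2 j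
        cases hD : D j
        · simp [this hD]
        · simp
      exact (Finset.card_le_card h1).trans (card_image_bits_in_le D)
    have h3 : (Q.filter pr).card ≤ 3 * (2 ^ m * 2 ^ m) :=
      hc.trans (Nat.mul_le_mul_left 3 (Nat.mul_le_mul hPJ2 hPJ2))
    exact_mod_cast h3
  -- Step 3: non-paired tuples through DCB
  have hN : ∑ q ∈ Q.filter (fun q => ¬ pr q), A q.1.1 * A q.1.2 * (A q.2.1 * A q.2.2) * K q ≤
      C * (2 : ℝ) ^ ((3 - κ) * (m : ℝ)) * p := by
    refine le_trans (Finset.sum_le_sum fun q _ => ?_) ((Finset.sum_le_sum fun q _ => le_rfl).trans hDCB)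
    calc A q.1.1 * A q.1.2 * (A q.2.1 * A q.2.2) * K q
        ≤ |A q.1.1 * A q.1.2 * (A q.2.1 * A q.2.2) * K q| := le_abs_self _
      _ = |K q| := by
          rw [abs_mul]
          have h1 : |A q.1.1 * A q.1.2 * (A q.2.1 * A q.2.2)| = 1 := by
            rw [abs_mul, abs_mul, abs_mul]
            have ha : ∀ z, |A z| = 1 := fun z => by rcases hA1 z with h | h <;> rw [h] <;> norm_num
            rw [ha, ha, ha, ha]; norm_num
          rw [h1, one_mul]
  -- Step 4: numerics
  have h2pos : (0 : ℝ) < 2 := by norm_num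
  have hp0 : (0 : ℝ) ≤ p := Nat.cast_nonneg _
  have hm0 : (0 : ℝ) ≤ m := Nat.cast_nonneg _
  have hpow1 : (2 : ℝ) ^ m * (2 : ℝ) ^ m ≤ (2 : ℝ) ^ ((3 - min κ 1) * (m : ℝ)) := by
    have e : (2 : ℝ) ^ m * (2 : ℝ) ^ m = (2 : ℝ) ^ (2 * (m : ℝ)) := by
      rw [← Real.rpow_natCast, ← Real.rpow_add h2pos]; ring_nf
    rw [e]
    refine Real.rpow_le_rpow_of_exponent_le (by norm_num) ?_
    have : min κ 1 ≤ 1 := min_le_right _ _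
    nlinarith
  have hpow2 : (2 : ℝ) ^ ((3 - κ) * (m : ℝ)) ≤ (2 : ℝ) ^ ((3 - min κ 1) * (m : ℝ)) := by
    refine Real.rpow_le_rpow_of_exponent_le (by norm_num) ?_
    have : min κ 1 ≤ κ := min_le_left _ _
    nlinarith
  calc ∑ q ∈ Q.filter pr, A q.1.1 * A q.1.2 * (A q.2.1 * A q.2.2) * K q +
        ∑ q ∈ Q.filter (fun q => ¬ pr q), A q.1.1 * A q.1.2 * (A q.2.1 * A q.2.2) * K q
      ≤ 3 * ((2 : ℝ) ^ m * (2 : ℝ) ^ m) * p + C * (2 : ℝ) ^ ((3 - κ) * (m : ℝ)) * p := add_le_add hP hN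
    _ ≤ 3 * (2 : ℝ) ^ ((3 - min κ 1) * (m : ℝ)) * p + C * (2 : ℝ) ^ ((3 - min κ 1) * (m : ℝ)) * p := by
        gcongr
    _ = (C + 3) * (2 : ℝ) ^ ((3 - min κ 1) * (m : ℝ)) * p := by ring

end FDMReduce

end Summit.QuantumAdvantage.QuantumAdvantage.Theorems.SymplecticPurity
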